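/-
Origin: expansion seat `planner-pub-hodgecm-mc-theta-3-g12-0`, handover (U2) 2026-08-20T04:02Z md5 cd21229a6218b4b429d23e7b8f412e51 (142 l.; NEW additive leaf over installed (F2) `HodgeCM.Model.ArchLineOrient`; the oriented recipe bit `orientBit L ι₁` with `orientBit_spec` = (F2)'s `hor` as a theorem; `archLineDatumOfOrientBit … (hc : SignRecipe.GoodCtx (orientBit L ι₁) ι₁ c)` = the row-5 line datum at good contexts of the oriented bit with NO orientation hypothesis; 8 theorems + 2 defs; rc 0 / 0 warn / trio 7/7) (`HOME/mc/pub-hodgecm-mc-theta-3-g12/lean/stage40/HodgeCM/Model/ArchLineOrientBit.lean`, md5 cd21229a6218, 142 lines);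
landed by the second packager p2 gen 2 (p2-g2) in gate run 40 as `HodgeCM/Model/ArchLineOrientBit.lean` (verbatim).
-/
/-
Origin: speedrun cell pub-hodgecm, MODEL-CONSTRUCTION sub-cell, lineage mc-theta-3 (BINDER-OWNERS row 5, the `𝔄` slot),
seat planner-pub-hodgecm-mc-theta-3-g12-0 (gen 12), 2026-08-20.  Target in PKG: `HodgeCM/Model/ArchLineOrientBit.lean`
(NEW additive leaf over `HodgeCM.Model.ArchLineOrient` (F2)).  KERNEL only: 0 records / named facts / proof holes.
-/
import Summits.HodgeConjecture.HodgeCM.Model.ArchLineOrient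

/-!
# The ORIENTED recipe bit: (F2)'s orientation hypothesis discharged by definition

(F2) `archLineDatumOfOrient` builds E's archimedean line datum at a good context `c` of PerL's recipe with bit `h`
from ONE orientation Prop `hor : 0 < im ((mk ι₁).embedding δ_L) ↔ h = false` (δ_L = `imagUnit L`), and proved that
under `GoodCtx h ι₁ c` each slot condition `hposₖ` is EQUIVALENT to `hor` (`hpos_iff_orient_of_goodCtx`).  The Prop
`0 < im ((mk ι₁).embedding δ_L)` is an opaque bit `o(L, ι₁)` of the universe (both `imagUnit` and Mathlib's place
representative are `Classical.choice` values), so with ONE global bit `h` the hypothesis `hor` holds in some universes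
and fails in others.  This leaf records the remedy on the recipe side: the **oriented bit**

  `orientBit L ι₁ := decide (im ((mk ι₁).embedding δ_L) < 0)`,

for which `hor` is a THEOREM (`orientBit_spec`), so that at every good context of the recipe with bit `orientBit L ι₁`
the line datum needs NO orientation hypothesis (`archLineDatumOfOrientBit`; read-back `archLineDatumOfOrientBit_eq`),
all four context lines ARE model-positive at `v₁` (`hpos_of_goodCtx_orientBit`), while at a good context of the OTHER
bit all four are model-negative at `v₁` (`not_hpos_of_goodCtx_not_orientBit`) — the formal content of SignRecipe (N2)
«`h = false` is read RELATIVE to `ψ_{ι₁}`».  The bit is a function of the PLACE of `ι₁` (`orientBit_conjugate`).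
Nothing is cited and nothing is minted: kernel lemmas over (F2).
-/

set_option autoImplicit false

noncomputable section

open NumberField NumberField.InfinitePlace NumberField.mixedEmbedding IsDedekindDomain
open scoped Matrix Classical ComplexConjugate
open Literature.NumberTheory.Automorphic Literature.NumberTheory.Automorphic.UnitaryGroup Literature.NumberTheory.Weil1964
open Literature.NumberTheory.GelbartRogawski1991 Literature.NumberTheory.GelbartRogawski1991.UnitaryDualPair
open HodgeCM.Adelic HodgeCM.PerL34 HodgeCM.Model.HypCensus HodgeCM.Model.SupplyInstance

namespace HodgeCM.Model.ArchSideTerm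

/-! ## 1. The oriented bit of a universe `(L, ι₁)` -/

section Bit

variable (L : CMField) (ι₁ : L →+* ℂ)

/-- **the oriented recipe bit** of the universe `(L, ι₁)`: `false` iff the cm-model's `ψ_{v₁}` is positively oriented,
i.e. iff `0 < im ((mk ι₁).embedding δ_L)`. -/
def orientBit : Bool :=
  decide (((InfinitePlace.mk ι₁).embedding (imagUnit (L : Type))).im < 0)

/-- **(F2)'s orientation hypothesis `hor` HOLDS for the oriented bit.** -/
theorem orientBit_spec :
    (0 < ((InfinitePlace.mk ι₁).embedding (imagUnit (L : Type))).im ↔ orientBit L ι₁ = false) := by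
  have hne : ((InfinitePlace.mk ι₁).embedding (imagUnit (L : Type))).im ≠ 0 := im_embedding_mk_imagUnit_ne_zero
  simp only [orientBit, decide_eq_false_iff_not, not_lt]
  exact ⟨le_of_lt, fun h => lt_of_le_of_ne h hne.symm⟩

/-- (Ported verbatim from the HodgeCMPerL package; no docstring in the source.) -/
theorem orientBit_eq_true_iff :
    orientBit L ι₁ = true ↔ ((InfinitePlace.mk ι₁).embedding (imagUnit (L : Type))).im < 0 := by
  simp only [orientBit, decide_eq_true_eq]

/-- (Ported verbatim from the HodgeCMPerL package; no docstring in the source.) -/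
theorem orientBit_eq_false_iff :
    orientBit L ι₁ = false ↔ 0 < ((InfinitePlace.mk ι₁).embedding (imagUnit (L : Type))).im :=
  (orientBit_spec L ι₁).symm

/-- the bit is a function of the PLACE of `ι₁`: it is the same at the conjugate embedding. -/
theorem orientBit_conjugate : orientBit L (ComplexEmbedding.conjugate ι₁) = orientBit L ι₁ := by
  simp only [orientBit, NumberField.InfinitePlace.mk_conjugate_eq]

end Bit

/-! ## 2. Slot signs at good contexts of the oriented bit and of the other bit -/

section Slots

variable {L : CMField} {ι₁ : L →+* ℂ} (V : HermSpace3 L ι₁) {c : SeesawCtx L}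

/-- **at a good context of the ORIENTED bit every context line is model-positive at `v₁`.** -/
theorem hpos_of_goodCtx_orientBit (hc : SignRecipe.GoodCtx (orientBit L ι₁) ι₁ c) (i : Fin 4)
    (hd : IsCMField.complexConj L (c.D.a i) = c.D.a i) :
    0 < cmXW (L : Type) (frameD V) (lineVec (L : Type) (c.D.a i)) (fun _ => hd) ι₁ (HypCensus.cmPlace (L : Type) ι₁) 0 :=
  (hpos_iff_orient_of_goodCtx V hc i hd).2 (orientBit_spec L ι₁)

/-- **at a good context of the OTHER bit every context line is model-NEGATIVE at `v₁`** (no slot condition holds). -/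
theorem not_hpos_of_goodCtx_not_orientBit (hc : SignRecipe.GoodCtx (!orientBit L ι₁) ι₁ c) (i : Fin 4)
    (hd : IsCMField.complexConj L (c.D.a i) = c.D.a i) :
    ¬ 0 < cmXW (L : Type) (frameD V) (lineVec (L : Type) (c.D.a i)) (fun _ => hd) ι₁ (HypCensus.cmPlace (L : Type) ι₁) 0 :=
  fun hpos => by
    have h₁ := (hpos_iff_orient_of_goodCtx V hc i hd).1 hpos
    have h₂ := orientBit_spec L ι₁
    cases hb : orientBit L ι₁ <;> simp_all

/-- hence, for a GLOBAL bit `h`, the slot condition at a good context of `h` holds iff `h` IS the oriented bit. -/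
theorem hpos_iff_eq_orientBit_of_goodCtx {h : Bool} (hc : SignRecipe.GoodCtx h ι₁ c) (i : Fin 4)
    (hd : IsCMField.complexConj L (c.D.a i) = c.D.a i) :
    0 < cmXW (L : Type) (frameD V) (lineVec (L : Type) (c.D.a i)) (fun _ => hd) ι₁ (HypCensus.cmPlace (L : Type) ι₁) 0 ↔
      h = orientBit L ι₁ := by
  rw [hpos_iff_orient_of_goodCtx V hc i hd, orientBit_spec L ι₁]
  cases h <;> cases orientBit L ι₁ <;> simp

end Slots

/-! ## 3. E's line datum at a good context of the oriented bit: no orientation hypothesis -/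

section Datum

variable {L : CMField} {ι₁ : L →+* ℂ} (V : HermSpace3 L ι₁) (c : SeesawCtx L)
variable
  (hGR : (cmSplittingDatum (L : Type) finProdFinEquiv (frameD V) (frameD_real V) (frameD_ne V) (dW c.D) (dW_real c.D)
    (dW_ne c.D)).CompatibleSplitting)
  (hGR₀ : (cmSplittingDatum (L : Type) (e₁) (frameD V) (frameD_real V) (frameD_ne V) (lineVec (L : Type) (dW c.D 0))
    (fun _ => dW_real c.D 0) (fun _ => dW_ne c.D 0)).CompatibleSplitting)
  (hGR₁ : (cmSplittingDatum (L : Type) (e₁) (frameD V) (frameD_real V) (frameD_ne V) (lineVec (L : Type) (dW c.D 1))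
    (fun _ => dW_real c.D 1) (fun _ => dW_ne c.D 1)).CompatibleSplitting)
  (hGR₂ : (cmSplittingDatum (L : Type) (e₁) (frameD V) (frameD_real V) (frameD_ne V) (lineVec (L : Type) (dW' c.D 0))
    (fun _ => dW'_real c.D 0) (fun _ => dW'_ne c.D 0)).CompatibleSplitting)
  (hGR₃ : (cmSplittingDatum (L : Type) (e₁) (frameD V) (frameD_real V) (frameD_ne V) (lineVec (L : Type) (dW' c.D 1))
    (fun _ => dW'_real c.D 1) (fun _ => dW'_ne c.D 1)).CompatibleSplitting)
  (η : CMAdelic (L : Type) (frameD V) × CMAdelic (L : Type) (dW c.D) →* ℂˣ)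
  (μ : Fin 4 → (InfinitePlace (L : Type) → ℤ))

/-- **E's archimedean line datum at a good context of the ORIENTED recipe**:
`archLineDatumOfOrientBit V c … η μ hc : (hμ₀ : …) → (hμ₁ : …) → (hμ₂ : …) → (hμ₃ : …) → ArchLineDatum V c.D hGR hGR₀ hGR₁ hGR₂ hGR₃ η μ`
— (F2)'s `archLineDatumOfOrient` with `hor` discharged by `orientBit_spec`; the four remaining binders are VERBATIM the
(J-μ) identities `hμₖ` of (F1)'s `archLineDatumOf`. -/
def archLineDatumOfOrientBit (hc : SignRecipe.GoodCtx (orientBit L ι₁) ι₁ c) :=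
  archLineDatumOfOrient V c hGR hGR₀ hGR₁ hGR₂ hGR₃ η μ hc (orientBit_spec L ι₁)

/-- read-back: the datum IS (F1)'s `archLineDatumOf` at the four slot conditions supplied by the oriented bit
(definitional) — in particular its test vectors are the degree-one vectors `linePhi`. -/
theorem archLineDatumOfOrientBit_eq (hc : SignRecipe.GoodCtx (orientBit L ι₁) ι₁ c) (hμ₀ hμ₁ hμ₂ hμ₃) :
    archLineDatumOfOrientBit V c hGR hGR₀ hGR₁ hGR₂ hGR₃ η μ hc hμ₀ hμ₁ hμ₂ hμ₃ =
      archLineDatumOf V c.D hGR hGR₀ hGR₁ hGR₂ hGR₃ η μ (hpos₀_of_orient V c hc (orientBit_spec L ι₁))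
        (hpos₁_of_orient V c hc (orientBit_spec L ι₁)) (hpos₂_of_orient V c hc (orientBit_spec L ι₁))
        (hpos₃_of_orient V c hc (orientBit_spec L ι₁)) hμ₀ hμ₁ hμ₂ hμ₃ :=
  rfl

end Datum

end HodgeCM.Model.ArchSideTerm

end
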